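import Summits.ValiantsHypothesis.ValiantsHypothesis.Theorems.FreeSubtorusOrbitDimensionBoundStubPerSummandExchange
import Literature.Computability.AlgebraicComplexity.PermanentIrreducible
import Literature.Computability.AlgebraicComplexity.EquivariantDC

/-!
# `OrbitDimensionBound` (stmt-ValiantsHypothesis-16133), rung line `sign_covering` — stub `stub_perSummand`

The line `Cruxes/OrbitDimensionBound/Lines/sign_covering.lean` (route `FreeSubtorus`, rung `Torsion.SignShadow`) reduces
the sign-equivariant covering bound `SignCovering` to four registered stubs; this file proves the FIRST one,

  `stub_perSummand : Stmt.stub_perSummand`,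

with the line's vocabulary (`IsSchurian`) UNFOLDED in the statement (no definitions are introduced; the skeleton's
`sorry` closes by `exact SignCovering.PerSummand.stub_perSummand`).

**Statement.**  A `Γ`-equivariant affine determinantal representation `B ∈ M_m(ℂ[x])` of `per_n` (`n ≥ 3`; exact
lifts `B(γ·x) = g B h⁻¹` for every `γ ∈ Γ ≤ GL(n²)`) can be replaced by a `Γ`-equivariant one `B'` of size `m' ≤ m`
whose pencil is SCHURIAN: every finite-order pair `(g, h) ∈ GL_{m'} × GL_{m'}` with `g B' = B' h` is a scalar pair
`(c, c)`.

**Proof** (Fitting's lemma and the Krull–Schmidt exchange for square affine matrix pencils; files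
`…StubPerSummandPrelimA/B/C`, `…StubPerSummandExchange`).  (1) `per_n` is irreducible (von zur Gathen), so by
`exists_local_retract` `B` has an affine LOCAL retract `N` of size `k ≤ m` with `det N = c' · per_n`: every
endomorphism pair of `N` is `μ + nilpotent`.  (2) By the exchange theorem `exists_lift_of_local_retract` every exact
lift of `γ ∈ Γ` to `B` yields an exact lift to `N`.  (3) Rescale `B' = ξ · N` with `ξ^k = 1/c'` so that
`det B' = per_n` exactly; lifts and endomorphism pairs are unchanged by the central factor.  (4) Schurian: a finite-order
`g ∈ GL_k(ℂ)` is semisimple (`X^r − 1` is separable in characteristic `0`), and `g − μ` is nilpotent by locality, so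
`g − μ = 0` (`Module.End.eq_zero_of_isNilpotent_isSemisimple`); likewise `h = μ`.

Helper mode (`--supports stmt-ValiantsHypothesis-16133 --as helper`): the line `sign_covering` is not the registered
skeleton of the item, so no stub credit moves.  Honest framing: a structural stub ([folklore] Krull–Schmidt / Fitting for
matrix pencils) of a dormant rung line whose core `stub_signLinearise` is worked elsewhere; the crux
`OrbitDimensionBound`, the route `FreeSubtorus` and VP ≠ VNP are OPEN and NOT moved by this file.

## References
* [LandsbergRessayre2017] J. M. Landsberg, N. Ressayre, *Permanent v. determinant: an exponential lower bound assuming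
  symmetry*, Differential Geom. Appl. 55 (2017), Def. 1.3, §3.3, §6.
* [Vonzurgathen1987] J. von zur Gathen, *Permanent and determinant*, Linear Algebra Appl. 96 (1987), Thm. 3.4.
* N. Jacobson, *Basic Algebra II*, 2nd ed. (1989), §3.4 (Fitting's lemma, Krull–Schmidt) — orientation only.
-/

set_option linter.dupNamespace false

namespace Summit.ValiantsHypothesis.ValiantsHypothesis.Theorems.FreeSubtorusOrbitDimensionBound.SignCovering.PerSummand

open Matrix MvPolynomial Finset Module.End
open Literature.Computability.AlgebraicComplexity
open Summit.ValiantsHypothesis.ValiantsHypothesis.Theorems.FreeSubtorusConfusionCovering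

/-! ### §1 Finite order plus unipotent-by-scalar is scalar -/

section FiniteOrder

/-- A complex matrix of finite order whose difference with a scalar is nilpotent IS that scalar (`X^r − 1` is separable
in characteristic `0`, so the matrix is semisimple, and a semisimple nilpotent endomorphism vanishes). [folklore] -/
theorem eq_smul_one_of_pow_eq_one_of_isNilpotent_sub {k : ℕ} (g : Matrix (Fin k) (Fin k) ℂ) {r : ℕ} (hr : 0 < r)
    (hg : g ^ r = 1) (μ : ℂ) (hμ : IsNilpotent (g - μ • (1 : Matrix (Fin k) (Fin k) ℂ))) :
    g = μ • (1 : Matrix (Fin k) (Fin k) ℂ) := by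
  set f : Module.End ℂ (Fin k → ℂ) := Matrix.toLin' g with hf
  have hsep : Squarefree (Polynomial.X ^ r - Polynomial.C (1 : ℂ)) :=
    (Polynomial.separable_X_pow_sub_C (1 : ℂ) (by exact_mod_cast hr.ne') one_ne_zero).squarefree
  have hss : f.IsSemisimple := by
    refine Module.End.isSemisimple_of_squarefree_aeval_eq_zero hsep ?_
    rw [map_sub, map_pow, Polynomial.aeval_X, Polynomial.aeval_C, map_one, hf, ← Matrix.toLin'_pow, hg,
      Matrix.toLin'_one, Module.End.one_eq_id, sub_self]
  have hss' : (f - algebraMap ℂ (Module.End ℂ (Fin k → ℂ)) μ).IsSemisimple :=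
    (Module.End.isSemisimple_sub_algebraMap_iff).2 hss
  have hlin : Matrix.toLin' (g - μ • (1 : Matrix (Fin k) (Fin k) ℂ)) = f - algebraMap ℂ (Module.End ℂ (Fin k → ℂ)) μ := by
    rw [map_sub, map_smul, Matrix.toLin'_one, hf, Algebra.algebraMap_eq_smul_one]; rfl
  have hnil : IsNilpotent (f - algebraMap ℂ (Module.End ℂ (Fin k → ℂ)) μ) := by
    rw [← hlin]; exact (Matrix.isNilpotent_toLin'_iff _).2 hμ
  have h0 : f - algebraMap ℂ (Module.End ℂ (Fin k → ℂ)) μ = 0 := Module.End.eq_zero_of_isNilpotent_isSemisimple hnil hss'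
  rw [← hlin] at h0
  have h1 : g - μ • (1 : Matrix (Fin k) (Fin k) ℂ) = 0 := by
    have := (Matrix.toLin' (R := ℂ) (n := Fin k)).map_eq_zero_iff.1 h0
    exact this
  exact sub_eq_zero.1 h1

end FiniteOrder

/-! ### §2 The stub -/

section Stub

/-- Entries of `(ξ · 1) · N` are `ξ` times the entries of `N`. [folklore] -/
theorem smul_one_map_C_mul_apply {k : ℕ} {σ : Type*} (ξ : ℂ) (N : Matrix (Fin k) (Fin k) (MvPolynomial σ ℂ))
    (i j : Fin k) :
    ((ξ • (1 : Matrix (Fin k) (Fin k) ℂ)).map C * N : Matrix (Fin k) (Fin k) (MvPolynomial σ ℂ)) i j = C ξ * N i j := by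
  rw [Matrix.mul_apply, Finset.sum_eq_single i]
  · simp
  · intro l _ hl
    simp [Ne.symm hl]
  · intro h; exact absurd (Finset.mem_univ _) h

/-- A central factor commutes past any constant matrix. [folklore] -/
theorem smul_one_mul_comm {k : ℕ} (ξ : ℂ) (g : Matrix (Fin k) (Fin k) ℂ) :
    ξ • (1 : Matrix (Fin k) (Fin k) ℂ) * g = g * (ξ • (1 : Matrix (Fin k) (Fin k) ℂ)) := by
  rw [Matrix.smul_mul, Matrix.one_mul, Matrix.mul_smul, Matrix.mul_one]

/-- **Stub 1 of the line `sign_covering` (`Stmt.stub_perSummand`, statement verbatim with `IsSchurian` unfolded):** an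
equivariant affine determinantal representation of `per_n` (`n ≥ 3`) under any `Γ ≤ GL(n²)` can be replaced by a
`Γ`-equivariant one of size `≤ m` whose pencil is Schurian — every finite-order pair `(g, h)` with `g B' = B' h` is a
scalar pair.  (Krull–Schmidt / Fitting for square affine matrix pencils: pass to the per-carrying indecomposable
summand, which is unique up to isomorphism because `per_n` is irreducible, hence respected by every lift; its
endomorphism pairs are `scalar + nilpotent`, and a finite-order unipotent-by-scalar matrix is scalar.)
[cite: LandsbergRessayre2017, Def. 1.3, §3.3] -/
theorem stub_perSummand :
    ∀ (n m : ℕ) (Γ : Subgroup (GL (Fin n × Fin n) ℂ)) (B : Matrix (Fin m) (Fin m) (MvPolynomial (Fin n × Fin n) ℂ)),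
      3 ≤ n → IsEquivariantDetRepr Γ (perPoly (Fin n) ℂ) B →
      ∃ (m' : ℕ) (B' : Matrix (Fin m') (Fin m') (MvPolynomial (Fin n × Fin n) ℂ)),
        m' ≤ m ∧ IsEquivariantDetRepr Γ (perPoly (Fin n) ℂ) B' ∧
        (∀ g h : GL (Fin m') ℂ,
          (g : Matrix (Fin m') (Fin m') ℂ).map C * B' = B' * (h : Matrix (Fin m') (Fin m') ℂ).map C →
          IsOfFinOrder g → IsOfFinOrder h →
          ∃ c : ℂ, (g : Matrix (Fin m') (Fin m') ℂ) = c • (1 : Matrix (Fin m') (Fin m') ℂ) ∧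
            (h : Matrix (Fin m') (Fin m') ℂ) = c • (1 : Matrix (Fin m') (Fin m') ℂ)) := by
  intro n m Γ B hn hB
  classical
  haveI : Nonempty (Fin n) := ⟨⟨0, by omega⟩⟩
  have hf : Irreducible (perPoly (Fin n) ℂ) := perPoly_irreducible
  have hdetB : B.det = C (1 : ℂ) * perPoly (Fin n) ℂ := by rw [C_1, one_mul]; exact hB.1.2
  obtain ⟨k, N, c', vW, vV, uW, uV, hk, hc', haffN, hdetN, hloc, hv, hu, huvW, huvV⟩ :=
    exists_local_retract hf m B 1 one_ne_zero hB.1.1 hdetB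
  -- `k ≥ 1`
  have hkpos : 0 < k := by
    rcases Nat.eq_zero_or_pos k with h0 | h0
    · exfalso
      subst h0
      have h1 : N.det = 1 := Matrix.det_isEmpty
      rw [h1] at hdetN
      exact hf.not_isUnit (IsUnit.of_mul_eq_one_right _ hdetN.symm)
    · exact h0
  -- rescale
  obtain ⟨ξ, hξ⟩ := IsAlgClosed.exists_pow_nat_eq (c'⁻¹) hkpos
  have hξ0 : ξ ≠ 0 := by
    intro h0; rw [h0, zero_pow hkpos.ne'] at hξ; exact inv_ne_zero hc' hξ.symm
  set Z : Matrix (Fin k) (Fin k) ℂ := ξ • (1 : Matrix (Fin k) (Fin k) ℂ) with hZ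
  set Zi : Matrix (Fin k) (Fin k) ℂ := ξ⁻¹ • (1 : Matrix (Fin k) (Fin k) ℂ) with hZi
  have hZiZ : Zi * Z = 1 := by
    rw [hZi, hZ, Matrix.smul_mul, Matrix.one_mul, smul_smul, inv_mul_cancel₀ hξ0, one_smul]
  set B' : Matrix (Fin k) (Fin k) (MvPolynomial (Fin n × Fin n) ℂ) := Z.map C * N with hB'
  refine ⟨k, B', hk, ⟨⟨?_, ?_⟩, ?_⟩, ?_⟩
  · -- affine
    intro i j
    rw [hB', hZ, smul_one_map_C_mul_apply]
    exact (totalDegree_mul _ _).trans (by rw [totalDegree_C, zero_add]; exact haffN i j)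
  · -- determinant
    rw [hB', Matrix.det_mul, det_map_C, hZ, Matrix.det_smul, Matrix.det_one, mul_one, Fintype.card_fin, hξ,
      hdetN, ← mul_assoc, ← map_mul, inv_mul_cancel₀ hc', C_1, one_mul]
  · -- equivariance
    intro γ hγ
    obtain ⟨G, H, hGH⟩ := hB.2 γ hγ
    obtain ⟨g, h, hgh⟩ := exists_lift_of_local_retract hf B 1 one_ne_zero hdetB N c' hc' hdetN hloc vW vV uW uV
      hv hu huvW huvV γ G H hGH
    refine ⟨g, h, ?_⟩
    rw [hB', Matrix.linSubstEntries_mul, Matrix.linSubstEntries_map_C, hgh]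
    simp only [← Matrix.mul_assoc]
    rw [← Matrix.map_mul, ← Matrix.map_mul, hZ, smul_one_mul_comm]
  · -- Schurian
    intro g h hgh hgfin hhfin
    -- strip the central factor: `g N = N h`
    have hgN : (g : Matrix (Fin k) (Fin k) ℂ).map C * N = N * (h : Matrix (Fin k) (Fin k) ℂ).map C := by
      have hZgZ : Zi * (g : Matrix (Fin k) (Fin k) ℂ) * Z = (g : Matrix (Fin k) (Fin k) ℂ) := by
        rw [Matrix.mul_assoc, hZ, ← smul_one_mul_comm, ← hZ, ← Matrix.mul_assoc, hZiZ, Matrix.one_mul]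
      have h1 : Zi.map C * ((g : Matrix (Fin k) (Fin k) ℂ).map C * B') =
          Zi.map C * (B' * (h : Matrix (Fin k) (Fin k) ℂ).map C) := by rw [hgh]
      have hL : Zi.map C * ((g : Matrix (Fin k) (Fin k) ℂ).map C * B') = (g : Matrix (Fin k) (Fin k) ℂ).map C * N := by
        rw [hB', ← Matrix.mul_assoc, ← Matrix.mul_assoc, ← Matrix.map_mul, ← Matrix.map_mul, hZgZ]
      have hR : Zi.map C * (B' * (h : Matrix (Fin k) (Fin k) ℂ).map C) = N * (h : Matrix (Fin k) (Fin k) ℂ).map C := by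
        rw [hB', ← Matrix.mul_assoc, ← Matrix.mul_assoc, ← Matrix.map_mul, hZiZ, Matrix.map_one C C_0 C_1,
          Matrix.one_mul]
      rw [hL, hR] at h1
      exact h1
    obtain ⟨μ, hμg, hμh⟩ := hloc _ _ hgN
    obtain ⟨r, hr, hgr⟩ := hgfin.exists_pow_eq_one
    obtain ⟨s, hs, hhs⟩ := hhfin.exists_pow_eq_one
    have hgr' : (g : Matrix (Fin k) (Fin k) ℂ) ^ r = 1 := by
      rw [← Units.val_pow_eq_pow_val, hgr, Units.val_one]
    have hhs' : (h : Matrix (Fin k) (Fin k) ℂ) ^ s = 1 := by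
      rw [← Units.val_pow_eq_pow_val, hhs, Units.val_one]
    exact ⟨μ, eq_smul_one_of_pow_eq_one_of_isNilpotent_sub _ hr hgr' μ hμg,
      eq_smul_one_of_pow_eq_one_of_isNilpotent_sub _ hs hhs' μ hμh⟩

end Stub

end Summit.ValiantsHypothesis.ValiantsHypothesis.Theorems.FreeSubtorusOrbitDimensionBound.SignCovering.PerSummand
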